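import Summits.HubbardSuperconductivity.HubbardSuperconductivity.Theorems.DeformationLadderLowEnergyRigidityTelescopeRigidity

/-!
# Telescope rigidity, part 6: macroscopic (top-scale) cell rigidity already gives pair-momentum rigidity

Route `DeformationLadder`, crux `LowEnergyRigidity` (item stmt-HubbardSuperconductivity-1892), line
`Sketch` (poincare-telescope). Support file (`--supports stmt-HubbardSuperconductivity-1892`).

Part 3 (`pairMomentumRigidity_of_josephsonInequalityAt`) used the telescope's full open input 1
(`JosephsonInequalityAt U δ J C ℓ₁`: ONE rate `J` and the slack shape `C J k³/L` at ALL cell counts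
`4 ≤ k ≤ L/ℓ₁`, mesoscopic ones included). Its proof only ever touches finitely many MACROSCOPIC cell
counts (`4, 8, …, k(K, σ)`), each with an `o(1)` slack. This file records the correspondingly weaker
hypothesis — **top-scale cell rigidity at `(U, δ)`**: for every fixed cell count `k ≥ 4` and every
`ε > 0` there are a rate `J = J(k, ε) > 0` and `L₀` with
`J · ((k/L)⁴ Re⟨φ, 𝒟_k φ⟩ − ε) ≤ Re⟨φ, H_L φ⟩ − E₀(L)` for all even `L ≥ L₀` and unit sector `φ` —
and proves that it ALREADY implies the body of `TwistGap.TgPairMomentumRigidity` at `(U, δ)`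
(`pairMomentumRigidity_of_topScaleRigidity`), while being implied by the Josephson family
(`topScaleRigidity_of_josephsonInequalityAt`). So the extra content of `stub_josephson` over TwistGap's
rigidity crux is exactly the uniformity in `k` up to mesoscopic scales (one `J`, slack `∝ k³/L`), which
the telescope needs only because its order input (`stub_floor`) sits at the lattice scale. CONDITIONAL
results (the hypotheses are conjecture-grade); no definitions are introduced (the hypothesis is written
inline). [folklore]
-/

noncomputable section

namespace Summit.HubbardSuperconductivity.HubbardSuperconductivity.Theorems.LowEnergyRigidity.Telescope

set_option linter.dupNamespace false -- summit = problem name (single-conjunct summit), D-0017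

open Matrix Literature.MathematicalPhysics.QuantumLattice Literature.Probability.LatticeModels
open scoped ComplexConjugate ComplexOrder Matrix.Norms.L2Operator
open Summit.HubbardSuperconductivity.HubbardSuperconductivity.Theses.DeformationLadder
open Summit.HubbardSuperconductivity.HubbardSuperconductivity.Theorems (minEnergyOn_le_re_rayleigh)

/-- An admissible cell count is at most twice the bottom count: if `L ≥ 2k` and `k' · ⌊L/k⌋ ≤ L`
then `k' ≤ 2k`. [folklore] -/
theorem rig_scale_le_two_mul {L k k' : ℕ} (hk : 0 < k) (hL : 2 * k ≤ L) (h : k' * (L / k) ≤ L) :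
    k' ≤ 2 * k := by
  by_contra hcon
  push Not at hcon
  have h1 : (2 * k + 1) * (L / k) ≤ k' * (L / k) := Nat.mul_le_mul_right _ hcon
  have h2 : L < L / k * k + k := Nat.lt_div_mul_add hk
  have h3 : 2 ≤ L / k := (Nat.le_div_iff_mul_le hk).mpr (by linarith)
  nlinarith

/-- **The Josephson family gives top-scale cell rigidity** (the new hypothesis is weaker): from
`JosephsonInequalityAt U δ J C ℓ₁` with `0 < J`, for every fixed `k ≥ 4` and `ε > 0` the
same rate `J` works with slack `ε` once `C k³/L ≤ ε`. [folklore] -/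
theorem topScaleRigidity_of_josephsonInequalityAt {U δ J C : ℝ} {ℓ₁ : ℕ} (hJ : 0 < J)
    (hJos : JosephsonInequalityAt U δ J C ℓ₁) :
    ∀ (k : ℕ) [NeZero k], 4 ≤ k → ∀ ε : ℝ, 0 < ε → ∃ J' : ℝ, 0 < J' ∧ ∃ L₀ : ℕ, ∀ (L : ℕ) [NeZero L], L₀ ≤ L → Even L →
      ∀ φ : Fock (Orb (FermionTorus 2 L)),
        φ ∈ (szSector (Λ := FermionTorus 2 L) (2 * ⌊(1 - δ) * (L : ℝ) ^ 2 / 2⌋₊) 0) → star φ ⬝ᵥ φ = 1 →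
        J' * (((k : ℝ) / (L : ℝ)) ^ 4 * (expect (cellDirichlet L k) φ).re - ε) ≤
          (expect (hubbardTorus 2 L 1 U) φ).re -
            (hubbardTorus 2 L 1 U).minEnergyOn (szSector (Λ := FermionTorus 2 L) (2 * ⌊(1 - δ) * (L : ℝ) ^ 2 / 2⌋₊) 0) := by
  intro k _ hk ε hε
  have hCp0 : (0 : ℝ) ≤ max C 0 := le_max_right _ _
  obtain ⟨LJ, hJosL⟩ := josephsonInequalityAt_mono_slack hJ (le_max_left C 0) hJos
  refine ⟨J, hJ, max (max LJ (k * ℓ₁)) (⌈max C 0 * (k : ℝ) ^ 3 / ε⌉₊ + 1), ?_⟩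
  intro L _ hL hev φ hφK hφ1
  have hLJ : LJ ≤ L := le_trans (le_trans (le_max_left _ _) (le_max_left _ _)) hL
  have hkℓ₁ : k * ℓ₁ ≤ L := le_trans (le_trans (le_max_right _ _) (le_max_left _ _)) hL
  have hLC : ⌈max C 0 * (k : ℝ) ^ 3 / ε⌉₊ + 1 ≤ L := le_trans (le_max_right _ _) hL
  have hLpos : (0 : ℝ) < L := by
    have : 1 ≤ L := le_trans (by omega) hLC
    exact_mod_cast this
  have h1 := hJosL L hLJ hev k hk hkℓ₁ φ hφK hφ1
  -- the slack `C J k³/L ≤ J ε`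
  have hslack : max C 0 * J * (k : ℝ) ^ 3 / (L : ℝ) ≤ J * ε := by
    have h2 : max C 0 * (k : ℝ) ^ 3 / ε ≤ (L : ℝ) := by
      have := Nat.le_ceil (max C 0 * (k : ℝ) ^ 3 / ε)
      have h3 : ((⌈max C 0 * (k : ℝ) ^ 3 / ε⌉₊ : ℕ) : ℝ) + 1 ≤ (L : ℝ) := by exact_mod_cast hLC
      linarith
    rw [div_le_iff₀ hε] at h2
    rw [div_le_iff₀ hLpos]
    nlinarith
  have h2 : J * (((k : ℝ) / (L : ℝ)) ^ 4 * (expect (cellDirichlet L k) φ).re - ε) =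
      J * ((k : ℝ) / (L : ℝ)) ^ 4 * (expect (cellDirichlet L k) φ).re - J * ε := by ring
  rw [h2]
  unfold expect at h1 ⊢
  linarith [h1, hslack]

/-- **Top-scale cell rigidity gives pair-momentum rigidity at the point.** At `(U, δ)`, if for every
fixed cell count `k ≥ 4` and every `ε > 0` some rate `J(k, ε) > 0` makes
`J · ((k/L)⁴ Re⟨φ, 𝒟_k φ⟩ − ε) ≤ Re⟨φ, H_L φ⟩ − minEnergyOn H_L (sector)` for all even `L ≥ L₀(k, ε)`
and unit sector vectors `φ`, then the body of `TwistGap.TgPairMomentumRigidity` holds at `(U, δ)`.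
Proof: as in part 3 with `C = 0`, using the hypothesis only at the cell counts `4 ≤ k' ≤ 2k(K, σ)`
(uniform rate `J = min J(k', σ/(2K+1)²)`, bottom scale `ℓ₁ = ⌊L/k⌋` in `stub_chain`).
CONDITIONAL (the hypothesis is conjecture-grade). [folklore] -/
theorem pairMomentumRigidity_of_topScaleRigidity :
    ∀ (U δ : ℝ),
    (∀ (k : ℕ) [NeZero k], 4 ≤ k → ∀ ε : ℝ, 0 < ε → ∃ J : ℝ, 0 < J ∧ ∃ L₀ : ℕ, ∀ (L : ℕ) [NeZero L], L₀ ≤ L → Even L →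
      ∀ φ : Fock (Orb (FermionTorus 2 L)),
        φ ∈ (szSector (Λ := FermionTorus 2 L) (2 * ⌊(1 - δ) * (L : ℝ) ^ 2 / 2⌋₊) 0) → star φ ⬝ᵥ φ = 1 →
        J * (((k : ℝ) / (L : ℝ)) ^ 4 * (expect (cellDirichlet L k) φ).re - ε) ≤
          (expect (hubbardTorus 2 L 1 U) φ).re -
            (hubbardTorus 2 L 1 U).minEnergyOn (szSector (Λ := FermionTorus 2 L) (2 * ⌊(1 - δ) * (L : ℝ) ^ 2 / 2⌋₊) 0)) →
    ∀ (K : ℕ) (σ : ℝ), 0 < σ → ∃ γ : ℝ, 0 < γ ∧ ∃ L₀ : ℕ, ∀ (L : ℕ) [NeZero L], L₀ ≤ L → Even L →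
      ∀ φ : Fock (Orb (FermionTorus 2 L)),
        φ ∈ (szSector (Λ := FermionTorus 2 L) (2 * ⌊(1 - δ) * (L : ℝ) ^ 2 / 2⌋₊) 0) → star φ ⬝ᵥ φ = 1 →
        γ * ((∑ k ∈ (Finset.univ.filter (fun k : TorusSite 2 L => k ≠ 0 ∧ ∀ i : Fin 2, min (k i).val (L - (k i).val) ≤ K)),
            (expect (Matrix.conjTranspose (∑ x : TorusSite 2 L, Complex.exp (-(2 * (Real.pi : ℂ) * Complex.I / (L : ℂ)) *
                ((∑ i : Fin 2, (k i).val * (x i).val : ℕ) : ℂ)) • localPair dWaveFormFactor L x) *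
              (∑ x : TorusSite 2 L, Complex.exp (-(2 * (Real.pi : ℂ) * Complex.I / (L : ℂ)) *
                ((∑ i : Fin 2, (k i).val * (x i).val : ℕ) : ℂ)) • localPair dWaveFormFactor L x)) φ).re / (L : ℝ) ^ 4) - σ) ≤
          (expect (hubbardTorus 2 L 1 U) φ).re -
            (hubbardTorus 2 L 1 U).minEnergyOn (szSector (Λ := FermionTorus 2 L) (2 * ⌊(1 - δ) * (L : ℝ) ^ 2 / 2⌋₊) 0) := by
  classical
  intro U δ hTop K σ hσ
  -- constants
  set p₀ : ℝ := 2 * ∑ e ∈ insert (0 : Site 2) unitSteps, |dWaveFormFactor e / Real.sqrt 2| with hp₀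
  have hp₀0 : 0 ≤ p₀ := by
    rw [hp₀]; exact mul_nonneg zero_le_two (Finset.sum_nonneg fun _ _ => abs_nonneg _)
  set M : ℝ := (((2 * K + 1) ^ 2 : ℕ) : ℝ) with hM
  have hM1 : (1 : ℝ) ≤ M := by
    rw [hM]; exact_mod_cast Nat.one_le_pow _ _ (Nat.succ_pos _)
  have hM0 : 0 < M := lt_of_lt_of_le one_pos hM1
  -- the dyadic cell count `k = 4·2^m`, `k > K`, `2 M (4πK p₀)² / k ≤ σ/2`
  set A : ℝ := max (K : ℝ) (4 * M * (4 * Real.pi * K * p₀) ^ 2 / σ) with hA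
  obtain ⟨m, hm⟩ := pow_unbounded_of_one_lt A (by norm_num : (1 : ℝ) < 2)
  set k : ℕ := 4 * 2 ^ m with hk
  haveI : NeZero k := ⟨by rw [hk]; positivity⟩
  have hkr : (k : ℝ) = 4 * (2 : ℝ) ^ m := by rw [hk]; push_cast; ring
  have hk1 : (1 : ℝ) ≤ k := by exact_mod_cast Nat.pos_of_ne_zero (NeZero.ne k)
  have hkpos : (0 : ℝ) < k := lt_of_lt_of_le one_pos hk1
  have hk4 : 4 ≤ k := by rw [hk]; exact Nat.le_mul_of_pos_right _ (Nat.two_pow_pos _)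
  have hkpos' : 0 < k := Nat.pos_of_ne_zero (NeZero.ne k)
  have hAk : A < k := by
    rw [hkr]
    have : (2 : ℝ) ^ m ≤ 4 * 2 ^ m := by nlinarith [pow_pos (two_pos : (0 : ℝ) < 2) m]
    exact lt_of_lt_of_le hm this
  have hKk : K < k := by
    have : (K : ℝ) < k := lt_of_le_of_lt (le_max_left _ _) hAk
    exact_mod_cast this
  have herr : 2 * M * (4 * Real.pi * K / k) ^ 2 * p₀ ^ 2 ≤ σ / 2 := by
    have h1 : 4 * M * (4 * Real.pi * K * p₀) ^ 2 / σ < k := lt_of_le_of_lt (le_max_right _ _) hAk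
    rw [div_lt_iff₀ hσ] at h1
    have h2 : 2 * M * (4 * Real.pi * K / k) ^ 2 * p₀ ^ 2 = (2 * M * (4 * Real.pi * K * p₀) ^ 2) / k ^ 2 := by
      field_simp
    rw [h2, div_le_iff₀ (by positivity)]
    have h3 : (k : ℝ) ≤ (k : ℝ) ^ 2 := by nlinarith
    nlinarith [hM0, sq_nonneg (4 * Real.pi * K * p₀)]
  -- the finitely many macroscopic scales `k' = n + 4 ≤ 2k`, each with slack `ε = σ/M`
  have hε : 0 < σ / M := div_pos hσ hM0
  have hNZ : ∀ n : ℕ, NeZero (n + 4) := fun n => ⟨by omega⟩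
  have hsc : ∀ n : ℕ, ∃ J : ℝ, 0 < J ∧ ∃ L₀ : ℕ, ∀ (L : ℕ) [NeZero L], L₀ ≤ L → Even L →
      ∀ φ : Fock (Orb (FermionTorus 2 L)),
        φ ∈ (szSector (Λ := FermionTorus 2 L) (2 * ⌊(1 - δ) * (L : ℝ) ^ 2 / 2⌋₊) 0) → star φ ⬝ᵥ φ = 1 →
        J * ((((n + 4 : ℕ) : ℝ) / (L : ℝ)) ^ 4 * (expect (@cellDirichlet L _ (n + 4) (hNZ n)) φ).re - σ / M) ≤
          (expect (hubbardTorus 2 L 1 U) φ).re -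
            (hubbardTorus 2 L 1 U).minEnergyOn (szSector (Λ := FermionTorus 2 L) (2 * ⌊(1 - δ) * (L : ℝ) ^ 2 / 2⌋₊) 0) :=
    fun n => @hTop (n + 4) (hNZ n) (by omega) (σ / M) hε
  choose Jf hJf Lf hLf using hsc
  -- a uniform rate on the scales `n ≤ 2k` and a common threshold
  obtain ⟨n₀, -, hn₀⟩ := Finset.exists_min_image (Finset.range (2 * k + 1)) Jf ⟨0, by simp⟩
  set J : ℝ := Jf n₀ with hJdef
  have hJ : 0 < J := hJf n₀
  have hJle : ∀ n, n ≤ 2 * k → J ≤ Jf n := fun n hn => hn₀ n (Finset.mem_range.mpr (by omega))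
  set Lmax : ℕ := ∑ n ∈ Finset.range (2 * k + 1), Lf n with hLmax
  have hLf_le : ∀ n, n ≤ 2 * k → Lf n ≤ Lmax := fun n hn =>
    Finset.single_le_sum (f := Lf) (fun _ _ => Nat.zero_le _) (Finset.mem_range.mpr (by omega))
  set L₀ : ℕ := max Lmax (2 * k) with hL₀
  refine ⟨12 * J / M, by positivity, L₀, ?_⟩
  intro L _ hL hev φ hφK hφ1
  have hLmaxL : Lmax ≤ L := le_trans (le_max_left _ _) hL
  have h2kL : 2 * k ≤ L := le_trans (le_max_right _ _) hL
  have hLpos : (0 : ℝ) < L := by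
    have : 1 ≤ L := le_trans (by omega) h2kL
    exact_mod_cast this
  -- abbreviations
  set H := hubbardTorus 2 L 1 U with hH
  set Sec := szSector (Λ := FermionTorus 2 L) (2 * ⌊(1 - δ) * (L : ℝ) ^ 2 / 2⌋₊) 0 with hSec
  set E : ℝ := (expect H φ).re - H.minEnergyOn Sec with hE
  -- the excess energy is nonnegative (variational principle)
  have hE0 : 0 ≤ E := sub_nonneg.mpr (minEnergyOn_le_re_rayleigh _ _ hφK hφ1)
  -- the bottom scale of the chain: `ℓ₁ = ⌊L/k⌋`, admissible counts are `≤ 2k`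
  set ℓ₁ : ℕ := L / k with hℓ₁
  have hkℓ₁ : k * ℓ₁ ≤ L := by rw [hℓ₁, mul_comm]; exact Nat.div_mul_le_self L k
  -- Josephson-shaped bounds with `C = 0` and budget `E + J σ/M` at every admissible count
  have hJk : ∀ (k' : ℕ) [NeZero k'], 4 ≤ k' → k' * ℓ₁ ≤ L →
      J * ((k' : ℝ) / (L : ℝ)) ^ 4 * (expect (cellDirichlet L k') φ).re - 0 * J * (k' : ℝ) ^ 3 / (L : ℝ) ≤
        E + J * (σ / M) := by
    intro k' _ hk' hk'ℓ
    have hk'2 : k' ≤ 2 * k := rig_scale_le_two_mul hkpos' h2kL hk'ℓ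
    obtain ⟨n, rfl⟩ : ∃ n, k' = n + 4 := ⟨k' - 4, by omega⟩
    have hn : n ≤ 2 * k := by omega
    have hLn : Lf n ≤ L := le_trans (hLf_le n hn) hLmaxL
    have h1 := hLf n L hLn hev φ hφK hφ1
    have hJn := hJf n
    have hinst : (expect (@cellDirichlet L _ (n + 4) (hNZ n)) φ).re = (expect (cellDirichlet L (n + 4)) φ).re := rfl
    rw [hinst] at h1
    set a : ℝ := (((n + 4 : ℕ) : ℝ) / (L : ℝ)) ^ 4 with ha
    set D : ℝ := (expect (cellDirichlet L (n + 4)) φ).re with hD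
    have h1' : Jf n * (a * D - σ / M) ≤ E := h1
    -- `a D − ε ≤ E / J_n ≤ E / J`
    have h2 : a * D - σ / M ≤ E / J := by
      have h3 : a * D - σ / M ≤ E / Jf n := by
        rw [le_div_iff₀' hJn]
        exact h1'
      exact h3.trans (div_le_div_of_nonneg_left hE0 hJ (hJle n hn))
    have h4 : J * (a * D - σ / M) ≤ E := by
      have := mul_le_mul_of_nonneg_left h2 hJ.le
      rwa [mul_div_cancel₀ _ hJ.ne'] at this
    have h6 : J * a * D - 0 * J * (((n + 4 : ℕ) : ℝ)) ^ 3 / (L : ℝ) = J * (a * D - σ / M) + J * (σ / M) := by ring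
    rw [h6]
    linarith [h4]
  have hE'0 : 0 ≤ E + J * (σ / M) := by positivity
  clear_value E
  -- the chain up to `k = 4·2^m`, the top step and the bound at `4`
  have hmℓ₁ : 4 * 2 ^ m * ℓ₁ ≤ L := hkℓ₁
  have hchain := stub_chain L J 0 (E + J * (σ / M)) ℓ₁ φ hJ le_rfl hE'0 hJk m hmℓ₁
  have htop := stub_topPoincare L φ
  have h4ℓ₁ : 4 * ℓ₁ ≤ L := le_trans (Nat.mul_le_mul_right _ hk4) hkℓ₁
  have hJ4 := hJk 4 (by norm_num) h4ℓ₁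
  simp only [Nat.cast_ofNat] at hJ4
  have hkcast : ((4 * 2 ^ m : ℕ) : ℝ) = (k : ℝ) := by rw [hk]
  rw [hkcast] at hchain
  rw [cellCoherence_congr L (show 4 * 2 ^ m = k from rfl)] at hchain
  have hbudget := rig_budget_arith (C := 0) (E := E + J * (σ / M)) (cK := (expect (cellCoherence L k) φ).re)
    hJ hLpos htop hJ4 hchain
  -- per-momentum bound
  have hP : ∀ k₀ ∈ Finset.univ.filter (fun k : TorusSite 2 L => k ≠ 0 ∧ ∀ i : Fin 2, min (k i).val (L - (k i).val) ≤ K),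
      (expect (Matrix.conjTranspose (∑ x : TorusSite 2 L, Complex.exp (-(2 * (Real.pi : ℂ) * Complex.I / (L : ℂ)) *
          ((∑ i : Fin 2, (k₀ i).val * (x i).val : ℕ) : ℂ)) • localPair dWaveFormFactor L x) *
        (∑ x : TorusSite 2 L, Complex.exp (-(2 * (Real.pi : ℂ) * Complex.I / (L : ℂ)) *
          ((∑ i : Fin 2, (k₀ i).val * (x i).val : ℕ) : ℂ)) • localPair dWaveFormFactor L x)) φ).re / (L : ℝ) ^ 4 ≤
        (E + J * (σ / M)) / (12 * J) + 2 * (4 * Real.pi * K / k) ^ 2 * p₀ ^ 2 := by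
    intro k₀ hk₀
    rw [Finset.mem_filter] at hk₀
    rw [rig_re_expect_gram]
    have h1 := rig_pairMode_sq_le L k K hKk k₀ hk₀.2.1 hk₀.2.2 φ
    have h2 := rig_sum_eucNorm_localPair_sq_le L hφ1
    rw [← hp₀] at h2
    have hL4 : (0 : ℝ) < (L : ℝ) ^ 4 := by positivity
    rw [div_le_iff₀ hL4]
    have h3 : 2 * (4 * Real.pi * K / k) ^ 2 * (L : ℝ) ^ 2 *
        ∑ x : TorusSite 2 L, eucNorm (localPair dWaveFormFactor L x *ᵥ φ) ^ 2 ≤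
        2 * (4 * Real.pi * K / k) ^ 2 * (L : ℝ) ^ 2 * ((L : ℝ) ^ 2 * p₀ ^ 2) :=
      mul_le_mul_of_nonneg_left h2 (by positivity)
    have h4 : 2 * (k : ℝ) ^ 2 * (expect (cellCoherence L k) φ).re -
        2 * (expect ((pairField dWaveFormFactor L)ᴴ * pairField dWaveFormFactor L) φ).re ≤
        2 * (L : ℝ) ^ 4 * ((E + J * (σ / M)) / (24 * J)) := by
      have := hbudget
      rw [div_mul_eq_mul_div, ← sub_div, div_le_iff₀ hL4] at this
      have h0 : (0 : ℝ) * ((k : ℝ) + 2) / L = 0 := by ring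
      rw [h0, add_zero] at this
      linarith
    have h5 := h1.trans (by linarith [h3, h4] : _ ≤ 2 * (L : ℝ) ^ 4 * ((E + J * (σ / M)) / (24 * J)) +
        2 * (4 * Real.pi * K / k) ^ 2 * (L : ℝ) ^ 2 * ((L : ℝ) ^ 2 * p₀ ^ 2))
    refine h5.trans (le_of_eq ?_)
    field_simp
    ring
  -- sum over the window
  have hβ0 : 0 ≤ (E + J * (σ / M)) / (12 * J) + 2 * (4 * Real.pi * K / k) ^ 2 * p₀ ^ 2 := by
    refine add_nonneg (div_nonneg hE'0 (by linarith)) ?_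
    exact mul_nonneg (mul_nonneg zero_le_two (sq_nonneg _)) (sq_nonneg _)
  have hcardW : ((Finset.univ.filter (fun k : TorusSite 2 L => k ≠ 0 ∧
      ∀ i : Fin 2, min (k i).val (L - (k i).val) ≤ K)).card : ℝ) ≤ M := by
    rw [hM]; exact_mod_cast rig_card_window_le L K
  have hsum : (∑ k₀ ∈ Finset.univ.filter (fun k : TorusSite 2 L => k ≠ 0 ∧ ∀ i : Fin 2, min (k i).val (L - (k i).val) ≤ K),
      (expect (Matrix.conjTranspose (∑ x : TorusSite 2 L, Complex.exp (-(2 * (Real.pi : ℂ) * Complex.I / (L : ℂ)) *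
          ((∑ i : Fin 2, (k₀ i).val * (x i).val : ℕ) : ℂ)) • localPair dWaveFormFactor L x) *
        (∑ x : TorusSite 2 L, Complex.exp (-(2 * (Real.pi : ℂ) * Complex.I / (L : ℂ)) *
          ((∑ i : Fin 2, (k₀ i).val * (x i).val : ℕ) : ℂ)) • localPair dWaveFormFactor L x)) φ).re / (L : ℝ) ^ 4)
      ≤ M * ((E + J * (σ / M)) / (12 * J) + 2 * (4 * Real.pi * K / k) ^ 2 * p₀ ^ 2) := by
    refine (Finset.sum_le_sum hP).trans ?_
    rw [Finset.sum_const, nsmul_eq_mul]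
    exact mul_le_mul_of_nonneg_right hcardW hβ0
  -- conclude: `M (E + Jσ/M)/(12J) = M E/(12J) + σ/12`
  have hfin : M * ((E + J * (σ / M)) / (12 * J) + 2 * (4 * Real.pi * K / k) ^ 2 * p₀ ^ 2) - σ ≤ M * (E / (12 * J)) := by
    have h1 : M * ((E + J * (σ / M)) / (12 * J)) = M * (E / (12 * J)) + σ / 12 := by
      field_simp
    have h2 : M * (2 * (4 * Real.pi * K / k) ^ 2 * p₀ ^ 2) ≤ σ / 2 := by
      have : M * (2 * (4 * Real.pi * K / k) ^ 2 * p₀ ^ 2) = 2 * M * (4 * Real.pi * K / k) ^ 2 * p₀ ^ 2 := by ring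
      rw [this]; exact herr
    have h3 : M * ((E + J * (σ / M)) / (12 * J) + 2 * (4 * Real.pi * K / k) ^ 2 * p₀ ^ 2) =
        M * ((E + J * (σ / M)) / (12 * J)) + M * (2 * (4 * Real.pi * K / k) ^ 2 * p₀ ^ 2) := by ring
    linarith only [h1, h2, h3, hσ]
  have hkey : (∑ k₀ ∈ Finset.univ.filter (fun k : TorusSite 2 L => k ≠ 0 ∧ ∀ i : Fin 2, min (k i).val (L - (k i).val) ≤ K),
      (expect (Matrix.conjTranspose (∑ x : TorusSite 2 L, Complex.exp (-(2 * (Real.pi : ℂ) * Complex.I / (L : ℂ)) *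
          ((∑ i : Fin 2, (k₀ i).val * (x i).val : ℕ) : ℂ)) • localPair dWaveFormFactor L x) *
        (∑ x : TorusSite 2 L, Complex.exp (-(2 * (Real.pi : ℂ) * Complex.I / (L : ℂ)) *
          ((∑ i : Fin 2, (k₀ i).val * (x i).val : ℕ) : ℂ)) • localPair dWaveFormFactor L x)) φ).re / (L : ℝ) ^ 4) - σ
      ≤ M * (E / (12 * J)) := by linarith only [hsum, hfin]
  have hγ : 0 < 12 * J / M := div_pos (by linarith) hM0
  calc 12 * J / M * (_ - σ) ≤ 12 * J / M * (M * (E / (12 * J))) := mul_le_mul_of_nonneg_left hkey hγ.le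
    _ = E := by field_simp

end Summit.HubbardSuperconductivity.HubbardSuperconductivity.Theorems.LowEnergyRigidity.Telescope
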